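import Summits.HodgeConjecture.CorCM.WeilLineClassesWeilWeightLines
import Literature.AlgebraicGeometry.HodgeTheory.EigenMonomialRationalDescent
import HarnessLib

/-!
# COR-CM (cell `pub-hodgecm2`): the `ℚ`-structure of Deligne's Weil space — `⋀^{2m}_K H¹(⨁_j A_j) ⊗ ℂ` is
# spanned by RATIONAL classes (Weil classes proper), and rational exceptional Weil classes exist

HONEST FRAMING (cell pub-hodgecm2 / COR-CM, literature typer `lit-deligne`; count-neutral: no binder row, no named
fact, nothing about algebraic cycles is asserted and no case of the Hodge conjecture is proved).  Sequel of
`CorCM/WeilLineClassesWeilWeightLines` (Deligne's Weil space `HodgeTheory.weilLineClasses B ι (2m)` of a product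
`B = ⨁_{j<2m} A_j` of realisations of CM types `Φ_j` of `K` IS the sum of the Pohlmann Weil weight lines, lies in
`Bᵐ(B) ⊗ ℂ` under Deligne's constant-sum hypothesis, and meets the divisor ring `Dᵐ(B) ⊗ ℂ` trivially unless the
family is conjugation-symmetric).  This file closes the second residual recorded in the cell's Deligne binder
table (`run/shared/lean/pub/pub-hodgecm2/lit/deligne82.md`, row 36: "Not done: … the `ℚ`-structure
`⋀^d_E H¹(B, ℚ)` of the sum of the Weil lines"):

* `exists_integer_separating_weilWeight` — there is `a₁ ∈ 𝓞_K` for which the rational operator `diag(a₁)^*` separates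
  the Weil monomials from all other cup monomials of `H^{2m}(B)` (`a₁ = n + a₀`, `a₀` separating the embeddings,
  `n ∈ ℕ` outside finitely many roots);
* **`weilLineClasses_eq_span_isRationalClass`** — `⋀^{2m}_K H¹(B) ⊗ ℂ` is the `ℂ`-span of its RATIONAL classes
  (the `ℚ`-structure `⋀^{2m}_K H¹(B, ℚ)`), by the type-free Galois descent
  `HodgeTheory.span_image_le_span_isRationalClass_of_stable` applied to the `Aut(ℂ)`-stable set of Weil monomials
  (`Δ × {s} ↦ Δ × {τ ∘ s}`);
* **`weilLineClasses_eq_span_weilClasses`** — under `Σ_j Φ_j = m` it is the `ℂ`-span of its rational classes of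
  Hodge type `(m, m)`: Deligne's WEIL CLASSES in print shape ("`⋀^d_E H¹(A, ℚ)(d/2) ⊂ H^d(A, ℚ)(d/2)` … consists
  of [absolute] Hodge cycles", [Deligne1982HodgeCycles, I §5 (c), p. 39]);
* **`exists_rational_weilClass_not_mem_divisorClassesSpan`** — for a constant-sum family that is not a union of
  conjugate pairs (`d(Ψ) ≠ d(Ψ̄)` for some `Ψ`) there is a rational `(m, m)` Weil class outside `Dᵐ(B) ⊗ ℂ` (indeed
  every non-zero class of the Weil space is outside, `WeilLineWeightLines.disjoint_weilLineClasses_divisorClassesSpan`):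
  the exceptional Hodge classes for which Deligne's §5 needs Thm. 4.8 rather than divisors
  ([Gordon1999HodgeAVSurvey, 9.2.2]; [Milne1999LefschetzClasses, Ex. 4.10] "the Weil classes are exotic").

References: [Deligne1982HodgeCycles] P. Deligne, *Hodge cycles on abelian varieties*, LNM 900 (1982), I Prop. 4.4
(p. 30), §5 (c) (pp. 38–39); [Milne2020HodgeClassesAV] J. S. Milne, *Hodge classes on abelian varieties* (2020),
1.2 and Theorem 1 (proof); [MoonenZarhin1998WeilClasses] §1; [Gordon1999HodgeAVSurvey] 9.2.2 and §9.3;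
[Milne1999LefschetzClasses] Duke Math. J. 96 (1999), Ex. 4.10; [SpringerLAG1998] Prop. 11.1.4;
[GaoUllmo2025] proof of Thm. 3.1.
-/

noncomputable section

namespace Summit.HodgeConjecture.CorCM.WeilLineWeightLines

open CategoryTheory CategoryTheory.Limits NumberField Polynomial
open Literature.AlgebraicTopology.SingularHomology
open Literature.AlgebraicGeometry Literature.AlgebraicGeometry.Motives Literature.AlgebraicGeometry.HodgeTheory
open Literature.AlgebraicGeometry.ComplexMultiplication
open Literature.AlgebraicGeometry.Pohlmann1968
open Literature.AlgebraicGeometry.Deligne1982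
open Literature.AlgebraicGeometry.VanGeemen1994 (hodgeClassSpan)
open Literature.Barriers.HodgeConjecture (divisorClassesSpan)
open Literature.NumberTheory.Automorphic.PicardCM (eigenline)
open Summit.HodgeConjecture.HodgeConjecture.Theorems.HodgeAbelianVarieties.CMPivotAndre
open Summit.HodgeConjecture.CorCM.AndreProductForm
open Summit.HodgeConjecture.CorCM.WeilLineMonomial

variable {K : Type} [Field K] [NumberField K]

section RationalStructure

variable {m : ℕ} {A : Fin (2 * m) → AbelianVariety ℂ} {ι : ∀ j, 𝓞 K →+* End (A j)}
  {θ : ∀ j, K →+* Module.End ℂ (complexBetti (A j).X 1)} {Φ : Fin (2 * m) → CMType K}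

/-! ## The Weil space in a cup-monomial eigenbasis -/

/-- **The Weil space in a cup-monomial eigenbasis**: for an eigenbasis `w` of `H¹(B)` for the torus `∏_j 𝓞_K`
(`Pohlmann1968.exists_eigenbasis_biproduct`) and the cup-monomial basis `b` of `H^{2m}(B)` on it
(`Pohlmann1968.exists_monomialBasis`), `⋀^{2m}_K H¹(B) ⊗ ℂ` is the span of the monomials `b u` of the Weil
weights `u = Δ × {s}` (the weight line of `u` is `ℂ · b u`, `Pohlmann1968.weightClassesAlg_eq_span_singleton`).
[cite: Milne2020HodgeClassesAV, 1.2 (a) and Theorem 1 (proof)] [cite: Deligne1982HodgeCycles, I §5 (c) (p. 38)] -/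
theorem weilLineClasses_eq_span_image (hA : ∀ j, IsCMTypeRealisation (Φ j) (A j) (ι j) (θ j))
    [LinearOrder ((_ : Fin (2 * m)) × (K →+* ℂ))]
    {w : Module.Basis ((_ : Fin (2 * m)) × (K →+* ℂ)) ℂ (complexBetti (⨁ A).X 1)}
    (hw : ∀ (c : ∀ _ : Fin (2 * m), 𝓞 K) (x : (_ : Fin (2 * m)) × (K →+* ℂ)),
      complexBetti.map (biproduct.map fun i => ι i (c i)).hom.hom.hom 1 (w x) = x.2 ((c x.1 : 𝓞 K) : K) • w x)
    {b : Module.Basis (Set.powersetCard ((_ : Fin (2 * m)) × (K →+* ℂ)) (2 * m)) ℂ (complexBetti (⨁ A).X (2 * m))}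
    (hb : ∀ u, b u = cupMonomial w (2 * m) u) :
    weilLineClasses A ι (2 * m) = Submodule.span ℂ
      (b '' {u | (u : Finset ((_ : Fin (2 * m)) × (K →+* ℂ))) ∈ Set.range (weilWeight (K := K) m)}) := by
  rw [weilLineClasses_eq_iSup_weightClassesAlg_weilWeight hA,
    show (⨆ s : K →+* ℂ, weightClassesAlg (K := fun _ : Fin (2 * m) => K) A ι (2 * m) (weilWeight m s)) =
        ⨆ S ∈ Set.range (weilWeight (K := K) m),
          weightClassesAlg (K := fun _ : Fin (2 * m) => K) A ι (2 * m) S from iSup_range.symm]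
  exact iSup_weightClassesAlg_eq_span_image (K := fun _ : Fin (2 * m) => K) hw hb
    (by rintro S ⟨s, rfl⟩; exact card_weilWeight s)

/-! ## A rational operator separating the Weil monomials, and the `ℚ`-structure -/

omit [NumberField K] in
/-- Root comparison (the step of p2's `WeilLineMonomial.eq_of_forall_prod_eq_pow` at ONE separating integer):
if `∏_{i ∈ t} (X + σ_i(a₀)) = (X + s(a₀))^{#t}` for an `a₀` separating the embeddings, every `σ_i` is `s`.
[cite: Milne2020HodgeClassesAV, 2.1–2.2] -/
private theorem eq_of_prod_X_add_C_eq_pow {a₀ : 𝓞 K}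
    (ha₀ : Function.Injective fun σ : K →+* ℂ => σ (a₀ : K))
    {ι' : Type*} (t : Finset ι') (σ : ι' → (K →+* ℂ)) (s : K →+* ℂ)
    (h : ∏ i ∈ t, (X + C (σ i (a₀ : K))) = (X + C (s (a₀ : K))) ^ t.card) : ∀ i ∈ t, σ i = s := by
  classical
  intro i hi
  have hQroots : ((X + C (s (a₀ : K))) ^ t.card).roots = Multiset.replicate t.card (-(s (a₀ : K))) := by
    rw [Polynomial.roots_pow, Polynomial.roots_X_add_C, Multiset.nsmul_singleton]
  have hPne : ∏ i ∈ t, (X + C (σ i (a₀ : K))) ≠ 0 := by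
    rw [h]; exact pow_ne_zero _ (X_add_C_ne_zero _)
  have hmem : -(σ i (a₀ : K)) ∈ (∏ i ∈ t, (X + C (σ i (a₀ : K)))).roots := by
    rw [Polynomial.mem_roots hPne, Polynomial.IsRoot.def, Polynomial.eval_prod]
    exact Finset.prod_eq_zero hi (by simp)
  rw [h, hQroots] at hmem
  exact ha₀ (neg_injective (Multiset.eq_of_mem_replicate hmem))

omit [NumberField K] in
/-- A `2m`-set of labels all carrying `s` IS the Weil weight of `s`. [cite: Deligne1982HodgeCycles, I §5 (c) (p. 38)] -/
private theorem eq_weilWeight_of_forall_snd_eq {t : Finset ((_ : Fin (2 * m)) × (K →+* ℂ))} {s : K →+* ℂ}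
    (ht : t.card = 2 * m) (h : ∀ x ∈ t, x.2 = s) : t = weilWeight m s :=
  Finset.eq_of_subset_of_card_le (fun x hx => (mem_weilWeight_iff s x).2 (h x hx))
    ((card_weilWeight s).le.trans ht.ge)

omit [NumberField K] in
/-- The character of the Weil weight of `s` at a diagonal integer: `∏_{(j,t) ∈ Δ×{s}} t(a) = s(a)^{2m}`.
[cite: Milne2020HodgeClassesAV, Theorem 1 (proof)] -/
theorem prod_weilWeight_const (a : K) (s : K →+* ℂ) :
    (∏ x ∈ weilWeight m s, x.2 a) = (s a) ^ (2 * m) := by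
  rw [weilWeight, colWeight, Finset.prod_map]
  simp only [Function.Embedding.coeFn_mk, Finset.prod_const, Finset.card_univ, Fintype.card_fin]

/-- **A diagonal integer separating the Weil monomials from all other cup monomials.**  There is `a₁ ∈ 𝓞_K`
such that a `2m`-set `t` of labels `(j, σ)` has character `∏_{(j,σ)∈t} σ(a₁) = s(a₁)^{2m}` only if `t = Δ × {s}`:
take `a₁ = n + a₀` with `a₀` separating the embeddings (`AndreProductForm.exists_integer_separating`) and `n ∈ ℕ`
outside the finitely many roots of the non-zero differences `∏_{(j,σ)∈t}(X + σ(a₀)) − (X + s(a₀))^{2m}`, `t ≠ Δ × {s}`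
(non-zero by `eq_of_prod_X_add_C_eq_pow`).  Compare p2's `WeilLineMonomial.eq_of_forall_prod_eq_pow`, which uses
ALL `a ∈ 𝓞_K`. [cite: Milne2020HodgeClassesAV, 2.1–2.2 and Theorem 1 (proof)] -/
theorem exists_integer_separating_weilWeight (K : Type) [Field K] [NumberField K] (m : ℕ) :
    ∃ a₁ : 𝓞 K, ∀ (t : Finset ((_ : Fin (2 * m)) × (K →+* ℂ))) (s : K →+* ℂ), t.card = 2 * m →
      (∏ x ∈ t, x.2 (a₁ : K)) = (s (a₁ : K)) ^ (2 * m) → t = weilWeight m s := by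
  classical
  obtain ⟨a₀, ha₀⟩ := exists_integer_separating K
  -- the difference polynomials of the "bad" pairs `(t, s)`, `t ≠ Δ × {s}`
  let D : Finset ((_ : Fin (2 * m)) × (K →+* ℂ)) × (K →+* ℂ) → ℂ[X] := fun p =>
    ∏ x ∈ p.1, (X + C (x.2 (a₀ : K))) - (X + C (p.2 (a₀ : K))) ^ (2 * m)
  let bad : Finset (Finset ((_ : Fin (2 * m)) × (K →+* ℂ)) × (K →+* ℂ)) :=
    Finset.univ.filter fun p => p.1.card = 2 * m ∧ p.1 ≠ weilWeight m p.2
  have hD : ∀ p ∈ bad, D p ≠ 0 := by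
    intro p hp hzero
    obtain ⟨hcard, hne⟩ := (Finset.mem_filter.1 hp).2
    apply hne
    have hPQ : ∏ x ∈ p.1, (X + C (x.2 (a₀ : K))) = (X + C (p.2 (a₀ : K))) ^ p.1.card := by
      rw [hcard]; exact sub_eq_zero.1 hzero
    exact eq_weilWeight_of_forall_snd_eq hcard (eq_of_prod_X_add_C_eq_pow ha₀ p.1 (fun x => x.2) p.2 hPQ)
  -- a natural number outside all their root sets
  let R : Finset ℂ := bad.biUnion fun p => (D p).roots.toFinset
  obtain ⟨_, ⟨n, rfl⟩, hn⟩ :=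
    (Set.infinite_range_of_injective (Nat.cast_injective (R := ℂ))).exists_notMem_finset R
  refine ⟨(n : 𝓞 K) + a₀, fun t s ht hprod => ?_⟩
  by_contra hne
  have hp : (t, s) ∈ bad := Finset.mem_filter.2 ⟨Finset.mem_univ _, ht, hne⟩
  apply hn
  refine Finset.mem_biUnion.2 ⟨(t, s), hp, ?_⟩
  rw [Multiset.mem_toFinset, Polynomial.mem_roots (hD _ hp), Polynomial.IsRoot.def]
  have h2 : ∏ x ∈ t, ((n : ℂ) + x.2 (a₀ : K)) = ((n : ℂ) + s (a₀ : K)) ^ (2 * m) := by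
    simpa only [map_add, map_natCast] using hprod
  simp only [D, Polynomial.eval_sub, Polynomial.eval_prod, Polynomial.eval_add, Polynomial.eval_X,
    Polynomial.eval_C, Polynomial.eval_pow, h2, sub_self]

/-- **Deligne's Weil space is defined over `ℚ`: `⋀^{2m}_K H¹(B) ⊗ ℂ` is the `ℂ`-span of its RATIONAL classes**
(for every family of realisations of CM types of `K`).  Galois descent (`span_image_le_span_isRationalClass_of_stable`)
for the set of Weil monomials, which `τ ∈ Aut(ℂ)` permutes (`Δ × {s} ↦ Δ × {τ ∘ s}`) and which the rational operator
`diag(a₁)^*` of `exists_integer_separating_weilWeight` separates from the other cup monomials.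
[cite: Deligne1982HodgeCycles, I §5 (c) (pp. 38–39): "`⋀^d_E H¹(A, ℚ)(d/2) ⊂ H^d(A, ℚ)(d/2)`"]
[cite: MoonenZarhin1998WeilClasses, §1] [cite: SpringerLAG1998, Prop. 11.1.4] -/
theorem weilLineClasses_le_span_isRationalClass (hA : ∀ j, IsCMTypeRealisation (Φ j) (A j) (ι j) (θ j)) :
    weilLineClasses A ι (2 * m) ≤
      Submodule.span ℂ {c | IsRationalClass c ∧ c ∈ weilLineClasses A ι (2 * m)} := by
  classical
  letI : LinearOrder ((_ : Fin (2 * m)) × (K →+* ℂ)) :=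
    LinearOrder.lift' (Fintype.equivFin _) (Fintype.equivFin _).injective
  have hX : IsSmoothProjective (⨁ A).dim (⨁ A).X := AbelianVariety.isSmoothProjective_holds
  obtain ⟨w, hw, -, -⟩ := exists_eigenbasis_biproduct (K := fun _ : Fin (2 * m) => K) hA
  obtain ⟨b, hb⟩ := exists_monomialBasis w (2 * m)
  obtain ⟨a₁, ha₁⟩ := exists_integer_separating_weilWeight K m
  -- labels, their `Aut(ℂ)`-permutations, and the Weil label sets
  let L := (_ : Fin (2 * m)) × (K →+* ℂ)
  let T := Set.powersetCard L (2 * m)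
  let perm : (ℂ ≃+* ℂ) → (L ↪ L) := fun τ =>
    ⟨fun x => ⟨x.1, (τ : ℂ →+* ℂ).comp x.2⟩, by
      rintro ⟨i, φ₁⟩ ⟨j, ψ⟩ h
      obtain ⟨h1, h2⟩ := Sigma.mk.inj_iff.1 h
      subst h1
      have h3 := eq_of_heq h2
      refine Sigma.ext rfl (heq_of_eq (RingHom.ext fun z => τ.injective ?_))
      have h4 := RingHom.congr_fun h3 z
      simpa only [RingHom.coe_comp, RingHom.coe_coe, Function.comp_apply] using h4⟩
  let gp : (ℂ ≃+* ℂ) → T → T := fun τ t => Set.powersetCard.map (2 * m) (perm τ) t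
  have hginj : ∀ τ, Function.Injective (gp τ) := fun τ t t' h =>
    Subtype.ext (Finset.map_injective (perm τ) (congrArg Subtype.val h))
  let B : Finset T := Finset.univ.filter fun u => (u : Finset L) ∈ Set.range (weilWeight (K := K) m)
  have hBcoe : (↑B : Set T) = {u : T | (u : Finset L) ∈ Set.range (weilWeight (K := K) m)} := by
    ext u; simp [B]
  have hpermW : ∀ (τ : ℂ ≃+* ℂ) (s : K →+* ℂ),
      (weilWeight m s).map (perm τ) = weilWeight m ((τ : ℂ →+* ℂ).comp s) := by
    intro τ s
    ext x
    rw [Finset.mem_map, mem_weilWeight_iff]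
    constructor
    · rintro ⟨y, hy, rfl⟩
      rw [mem_weilWeight_iff] at hy
      change (τ : ℂ →+* ℂ).comp y.2 = _
      rw [hy]
    · intro hx
      refine ⟨⟨x.1, s⟩, (mem_weilWeight_iff s _).2 rfl, ?_⟩
      obtain ⟨j, u⟩ := x
      change (⟨j, (τ : ℂ →+* ℂ).comp s⟩ : L) = ⟨j, u⟩
      rw [← hx]
  have hBs : ∀ τ, ∀ t ∈ B, gp τ t ∈ B := by
    intro τ t ht
    obtain ⟨s, hs⟩ := (Finset.mem_filter.1 ht).2
    refine Finset.mem_filter.2 ⟨Finset.mem_univ _, (τ : ℂ →+* ℂ).comp s, ?_⟩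
    rw [← hpermW τ s, hs]
    rfl
  -- the separating rational operator `φ = diag(a₁)^*`, diagonal in `b`
  let φ : Module.End ℂ (complexBetti (⨁ A).X (2 * m)) :=
    (complexBetti.map (biproduct.map fun i => ι i a₁).hom.hom.hom (2 * m)).hom
  have hφrat : ∀ ⦃x : complexBetti (⨁ A).X (2 * m)⦄, IsRationalClass x → IsRationalClass (φ x) :=
    fun x hx => hx.pullback _
  let e : T → ℂ := fun t => ∏ x ∈ (t : Finset L), x.2 (a₁ : K)
  have hφb : ∀ t, φ (b t) = e t • b t := fun t =>
    map_monomial_eq_prod_smul hb _ (hw fun _ => a₁) t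
  have hg : ∀ (τ : ℂ ≃+* ℂ) (t : T), (τ : ℂ →+* ℂ) (e t) = e (gp τ t) := fun τ t => by
    change (τ : ℂ →+* ℂ) (∏ x ∈ (t : Finset L), x.2 (a₁ : K)) =
      ∏ x ∈ ((Set.powersetCard.map (2 * m) (perm τ) t : T) : Finset L), x.2 (a₁ : K)
    rw [map_prod, Set.powersetCard.val_map, Finset.prod_map]
    rfl
  have hsep : ∀ t ∈ B, ∀ t', t' ∉ B → e t ≠ e t' := by
    intro t ht t' ht' hee
    obtain ⟨s, hs⟩ := (Finset.mem_filter.1 ht).2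
    apply ht'
    refine Finset.mem_filter.2 ⟨Finset.mem_univ _, s, ?_⟩
    have het : e t = (s (a₁ : K)) ^ (2 * m) := by
      change ∏ x ∈ (t : Finset L), x.2 (a₁ : K) = _
      rw [← hs, prod_weilWeight_const]
    exact (ha₁ _ s (Set.powersetCard.card_eq t') (by rw [← het, hee])).symm
  -- descent
  have hdesc := span_image_le_span_isRationalClass_of_stable hX b φ hφrat e hφb gp hginj hg B hBs hsep
  have hW : weilLineClasses A ι (2 * m) = Submodule.span ℂ (b '' ↑B) := by
    rw [hBcoe]; exact weilLineClasses_eq_span_image hA hw hb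
  rw [hW]
  exact hdesc

/-- **`⋀^{2m}_K H¹(B) ⊗ ℂ = span_ℂ` of its rational classes** (both inclusions).
[cite: Deligne1982HodgeCycles, I §5 (c) (pp. 38–39)] [cite: SpringerLAG1998, Prop. 11.1.4] -/
theorem weilLineClasses_eq_span_isRationalClass (hA : ∀ j, IsCMTypeRealisation (Φ j) (A j) (ι j) (θ j)) :
    weilLineClasses A ι (2 * m) =
      Submodule.span ℂ {c | IsRationalClass c ∧ c ∈ weilLineClasses A ι (2 * m)} :=
  le_antisymm (weilLineClasses_le_span_isRationalClass hA) (Submodule.span_le.2 fun _ hc => hc.2)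

/-- **Deligne's Weil classes, in print shape.** Under the constant-sum hypothesis `Σ_j Φ_j = m` the Weil space
`⋀^{2m}_K H¹(B) ⊗ ℂ` is the `ℂ`-span of the RATIONAL classes of Hodge type `(m, m)` it contains
("`⋀^d_E H¹(A, ℚ)(d/2) ⊂ H^d(A, ℚ)(d/2)` … consists of [absolute] Hodge cycles"): the rational classes of the
`ℚ`-structure (`weilLineClasses_eq_span_isRationalClass`) lie in `Bᵐ(B) ⊗ ℂ` (`weilLineClasses_le_hodgeClassSpan`),
hence in the type piece `(m, m)` of a Hodge model (`HodgeModel.mem_typePiece_of_isOfHodgeType`, a submodule).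
[cite: Deligne1982HodgeCycles, I §5 (c) (pp. 38–39) and Prop. 4.4 (p. 30)] [cite: Milne2020HodgeClassesAV, 1.2] -/
theorem weilLineClasses_eq_span_weilClasses (hA : ∀ j, IsCMTypeRealisation (Φ j) (A j) (ι j) (θ j))
    (hsum : ∀ t : K →+* ℂ, {j : Fin (2 * m) | t ∈ (Φ j).1}.ncard = m) :
    weilLineClasses A ι (2 * m) = Submodule.span ℂ {c | IsRationalClass c ∧
      IsOfHodgeType (⨁ A).dim (⨁ A).X (2 * m) m m c ∧ c ∈ weilLineClasses A ι (2 * m)} := by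
  have hX : IsSmoothProjective (⨁ A).dim (⨁ A).X := AbelianVariety.isSmoothProjective_holds
  obtain ⟨M⟩ := nonempty_hodgeModel_holds (n := (⨁ A).dim) (X := (⨁ A).X) hX
  let u₀ : ↥(Finset.HasAntidiagonal.antidiagonal (2 * m)) :=
    ⟨(m, m), Finset.HasAntidiagonal.mem_antidiagonal.2 (two_mul m).symm⟩
  have htp : weilLineClasses A ι (2 * m) ≤ M.typePiece (2 * m) u₀ :=
    (weilLineClasses_le_hodgeClassSpan hA hsum).trans (Submodule.span_le.2 fun c hc =>
      M.mem_typePiece_of_isOfHodgeType hodgePQ_independent_of_hodgeModel_holds hX _ hc.2)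
  refine le_antisymm ?_ (Submodule.span_le.2 fun _ hc => hc.2.2)
  refine (weilLineClasses_le_span_isRationalClass hA).trans (Submodule.span_mono fun c hc => ?_)
  refine ⟨hc.1, ?_, hc.2⟩
  change IsOfHodgeType (⨁ A).dim (⨁ A).X (2 * m) u₀.1.1 u₀.1.2 c
  exact M.isOfHodgeType_of_mem_typePiece (htp hc.2)

/-- **Rational exceptional Weil classes exist.** For a constant-sum family that is not a union of conjugate pairs
(`d(Ψ) ≠ d(Ψ̄)` for some `Ψ`) there is a RATIONAL class of Hodge type `(m, m)` in Deligne's Weil space outside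
`Dᵐ(B) ⊗ ℂ` — and every non-zero class of the Weil space is outside (`disjoint_weilLineClasses_divisorClassesSpan`).
These are the Hodge classes on `⊕_j A_{Φ_j}` for which Deligne's §5 needs Thm. 4.8 rather than divisors.
[cite: Deligne1982HodgeCycles, I §5 (c) (pp. 38–39)] [cite: Gordon1999HodgeAVSurvey, 9.2.2 and §9.3]
[cite: Milne1999LefschetzClasses, Example 4.10] -/
theorem exists_rational_weilClass_not_mem_divisorClassesSpan
    (hA : ∀ j, IsCMTypeRealisation (Φ j) (A j) (ι j) (θ j))
    (hsum : ∀ t : K →+* ℂ, {j : Fin (2 * m) | t ∈ (Φ j).1}.ncard = m) (hne : ∃ S, typeCount Φ S ≠ typeCount Φ Sᶜ) :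
    ∃ c ∈ weilLineClasses A ι (2 * m), IsRationalClass c ∧
      IsOfHodgeType (⨁ A).dim (⨁ A).X (2 * m) m m c ∧ c ∉ divisorClassesSpan (⨁ A).X (⨁ A).dim m := by
  by_contra hcon
  push Not at hcon
  apply weilLineClasses_ne_bot hA
  rw [weilLineClasses_eq_span_weilClasses hA hsum, Submodule.span_eq_bot]
  rintro c ⟨hcQ, hcH, hcW⟩
  have hcD : c ∈ divisorClassesSpan (⨁ A).X (⨁ A).dim m := hcon c hcW hcQ hcH
  exact (disjoint_weilLineClasses_divisorClassesSpan hA hne).le_bot ⟨hcW, hcD⟩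

end RationalStructure

end Summit.HodgeConjecture.CorCM.WeilLineWeightLines

end
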